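import Literature.AnabelianGeometry.SemiGraphs.TreeSystemSubjointSelection
import HarnessLib

/-!
# Compatible fixed subjoint systems from fixed edge-pairs over a base edge-pair ([SemiAnbd] Thm. 3.7 (iii), p. 41)

Mochizuki, *Semi-graphs of anabelioids*, Publ. RIMS **42** (2006), §3, Theorem 3.7 (iii), author's
manuscript p. 41, third paragraph of the proof, with the author's *Comments* (2020), item (6)(b)
("we may choose a compatible system of such subjoints"). [cite: MochizukiSemiAnbd2006, Thm. 3.7(iii)
p.41]

PROOF-ONLY, GENERIC sequel of `TreeSystemSubjointSelection.lean` (cell abc-iut, layer L3, GAP row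
G-t6g3-2b, shared sub-row **G2·GEN-ENDS** of L3-lead ruling α38 (3); seat abc-iut-w5-d189; no
definition, nothing specific to anabelioids): the EDGE currency of the Kőnig selection.  In the
`(T, f, ρ)` tree-system currency over a base `B` (`π j : T j ⟶ B`, `f ≫ π i = π j`, functorial `f`,
equivariant `ρ`):

* `SemiGraph.exists_fixedSubjointSystem_over_edges` — if above a level `j₀` every tree `T j` carries
  a `C`-fixed vertex `w` over the base vertex `u` with two `C`-fixed edges abutting to it over two
  DISTINCT base edges `e ≠ e'` (e.g. two consecutive edges of a `C`-fixed lift of a base path or ray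
  through `u`), the `C`-fixed vertices over `u` are FINITE at each level and every vertex has
  finitely many edges over `e`, `e'`, then there is a compatible `C`-fixed subjoint system `(m i; δ
  i, δ' i)_{i ≥ j₀}` with branches over `e`, `e'` — the branches of the two edges at `w` are unique
  and fixed (trees: `branch_unique_of_isTree`, `branchMap_eq_of_edgeMap_vertexMap_eq`, abc-
  iut-L3-t10), the family is finite by `finite_branches_of_finite_edges` and trans-stable because `e
  ≠ e'` forbids folding (`edgeMap_over`), and Kőnig (`exists_fixedSubjointSystem_of_finite_family`)
  selects;
* `SemiGraph.exists_fixedSubjointSystem_over_edges_of_cofinal` — the datum is needed only at a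
  COFINAL set of levels (it descends along the transition maps, `SemiGraph.fixedEdgePairOver_map`);
* `SemiGraph.eq_bot_of_fixedEdgePairs_over` — composed with abc-iut-L3-t10's estrangement kill
  `SemiGraph.eq_bot_of_fixedSubjointSystem`: `C = ⊥`.

HONEST LIMIT as in the parent file: these serve the non-escaping branches of G-t6g3-2b only; nothing
here asserts (FIX∞) for an infinite `𝔾`; nothing bears on [IUTchIII] Cor. 3.12.
-/

namespace Literature.AnabelianGeometry.SemiGraphs

namespace SemiGraph

open CategoryTheory

universe w v u

section Over

variable {P : Type w} [Group P] (C : Subgroup P) {J : Type v} [Preorder J]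
  (T : J → SemiGraph.{u}) (ρ : ∀ j, P →* Aut (T j)) (f : ∀ ⦃i j : J⦄, i ≤ j → (T j ⟶ T i))
  {B : SemiGraph.{u}} (π : ∀ j, T j ⟶ B)

/-- No folding over distinct base edges (edge form of `branchMap_ne_of_over`).
[cite: MochizukiSemiAnbd2006, Thm. 3.7(iii) p.41] -/
theorem edgeMap_ne_of_over (hover : ∀ ⦃i j : J⦄ (h : i ≤ j), f h ≫ π i = π j) ⦃i j : J⦄
    (h : i ≤ j) {ε ε' : (T j).Edge} (hne : (π j).edgeMap ε ≠ (π j).edgeMap ε') :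
    (f h).edgeMap ε ≠ (f h).edgeMap ε' := by
  intro heq
  apply hne
  rw [← edgeMap_over T f π hover h ε, ← edgeMap_over T f π hover h ε', heq]

/-- Equivariance of the transition maps on edges, pointwise.
[cite: MochizukiSemiAnbd2006, Thm. 3.7(iii) p.41] -/
theorem edgeMap_equiv
    (hequiv : ∀ ⦃i j : J⦄ (h : i ≤ j) (g : P), (ρ j g).hom ≫ f h = f h ≫ (ρ i g).hom)
    ⦃i j : J⦄ (h : i ≤ j) (g : P) (ε : (T j).Edge) :
    (ρ i g).hom.edgeMap ((f h).edgeMap ε) = (f h).edgeMap ((ρ j g).hom.edgeMap ε) := by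
  have e := congrArg (fun φ : T j ⟶ T i => φ.edgeMap ε) (hequiv h g)
  simp only [comp_edgeMap, Function.comp_apply] at e
  exact e.symm

/-- **`C`-fixed edge-pairs over a base edge-pair descend along the transition maps**: the image of a
`C`-fixed vertex over `u` with two `C`-fixed abutting edges over `e`, `e'` is again such a datum (over
the base, equivariance). [cite: MochizukiSemiAnbd2006, Thm. 3.7(iii) p.41] -/
theorem fixedEdgePairOver_map (hover : ∀ ⦃i j : J⦄ (h : i ≤ j), f h ≫ π i = π j)
    (hequiv : ∀ ⦃i j : J⦄ (h : i ≤ j) (g : P), (ρ j g).hom ≫ f h = f h ≫ (ρ i g).hom)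
    (u : B.Vertex) (e e' : B.Edge) ⦃i j : J⦄ (h : i ≤ j) (w : (T j).Vertex) (ε ε' : (T j).Edge)
    (hw : (π j).vertexMap w = u ∧ (π j).edgeMap ε = e ∧ (π j).edgeMap ε' = e' ∧
      (T j).EdgeAbuts ε w ∧ (T j).EdgeAbuts ε' w ∧
      ∀ γ : C, (ρ j γ).hom.vertexMap w = w ∧ (ρ j γ).hom.edgeMap ε = ε ∧
        (ρ j γ).hom.edgeMap ε' = ε') :
    (π i).vertexMap ((f h).vertexMap w) = u ∧ (π i).edgeMap ((f h).edgeMap ε) = e ∧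
      (π i).edgeMap ((f h).edgeMap ε') = e' ∧
      (T i).EdgeAbuts ((f h).edgeMap ε) ((f h).vertexMap w) ∧
      (T i).EdgeAbuts ((f h).edgeMap ε') ((f h).vertexMap w) ∧
      ∀ γ : C, (ρ i γ).hom.vertexMap ((f h).vertexMap w) = (f h).vertexMap w ∧
        (ρ i γ).hom.edgeMap ((f h).edgeMap ε) = (f h).edgeMap ε ∧
        (ρ i γ).hom.edgeMap ((f h).edgeMap ε') = (f h).edgeMap ε' := by
  obtain ⟨hwu, hε, hε', ⟨β, hβe, hβw⟩, ⟨β', hβ'e, hβ'w⟩, hfix⟩ := hw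
  refine ⟨by rw [vertexMap_over T f π hover h, hwu], by rw [edgeMap_over T f π hover h, hε],
    by rw [edgeMap_over T f π hover h, hε'],
    ⟨(f h).branchMap β, by rw [(f h).edgeOf_branchMap, hβe], (f h).abuts_branchMap _ _ hβw⟩,
    ⟨(f h).branchMap β', by rw [(f h).edgeOf_branchMap, hβ'e], (f h).abuts_branchMap _ _ hβ'w⟩,
    fun γ => ⟨?_, ?_, ?_⟩⟩
  · rw [vertexMap_equiv T ρ f hequiv h, (hfix γ).1]
  · rw [edgeMap_equiv T ρ f hequiv h, (hfix γ).2.1]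
  · rw [edgeMap_equiv T ρ f hequiv h, (hfix γ).2.2]

/-! ### Edge currency: fixed edge-pairs over a base edge-pair -/

/-- **Compatible `C`-fixed subjoint system from fixed EDGE-pairs over a base edge-pair.**  Let
`e ≠ e'` be base edges and `u` a base vertex; suppose the `T j` are trees.  If above `j₀` every level
carries a `C`-fixed vertex `w` over `u` with two `C`-fixed edges `ε`, `ε'` abutting to it over `e`, `e'`
(e.g. two consecutive edges of a `C`-fixed lift of a base path through `u`), the `C`-fixed vertices over
`u` are finite and each vertex has finitely many edges over `e`, `e'`, then there is a compatible
`C`-fixed subjoint system `(m i; δ i, δ' i)_{i ≥ j₀}` whose branches lie over `e`, `e'` — the branches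
of `ε`, `ε'` at `w` are unique and fixed (`branch_unique_of_isTree`,
`branchMap_eq_of_edgeMap_vertexMap_eq`), and no transition map folds them since `e ≠ e'`.
[cite: MochizukiSemiAnbd2006, Thm. 3.7(iii) p.41] -/
theorem exists_fixedSubjointSystem_over_edges [IsDirectedOrder J] (hT : ∀ j, (T j).IsTree)
    (hid : ∀ j, f (le_refl j) = 𝟙 (T j))
    (hcomp : ∀ ⦃i j k : J⦄ (hij : i ≤ j) (hjk : j ≤ k), f hjk ≫ f hij = f (hij.trans hjk))
    (hover : ∀ ⦃i j : J⦄ (h : i ≤ j), f h ≫ π i = π j)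
    (hequiv : ∀ ⦃i j : J⦄ (h : i ≤ j) (g : P), (ρ j g).hom ≫ f h = f h ≫ (ρ i g).hom)
    (u : B.Vertex) (e e' : B.Edge) (hee' : e ≠ e') (j₀ : J)
    (hne : ∀ j, j₀ ≤ j → ∃ (w : (T j).Vertex) (ε ε' : (T j).Edge), (π j).vertexMap w = u ∧
      (π j).edgeMap ε = e ∧ (π j).edgeMap ε' = e' ∧ (T j).EdgeAbuts ε w ∧ (T j).EdgeAbuts ε' w ∧
      ∀ γ : C, (ρ j γ).hom.vertexMap w = w ∧ (ρ j γ).hom.edgeMap ε = ε ∧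
        (ρ j γ).hom.edgeMap ε' = ε')
    (hfinV : ∀ j, j₀ ≤ j → {w : (T j).Vertex | (π j).vertexMap w = u ∧
      ∀ γ : C, (ρ j γ).hom.vertexMap w = w}.Finite)
    (hfinE : ∀ j, j₀ ≤ j → ∀ w : (T j).Vertex, {ε : (T j).Edge | (T j).EdgeAbuts ε w ∧
      ((π j).edgeMap ε = e ∨ (π j).edgeMap ε = e')}.Finite) :
    ∃ (m : ∀ i : {i : J // j₀ ≤ i}, (T i.1).Vertex)
      (δ δ' : ∀ i : {i : J // j₀ ≤ i}, (T i.1).Branch),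
      (∀ i, (π i.1).vertexMap (m i) = u ∧ (π i.1).edgeMap ((T i.1).edgeOf (δ i)) = e ∧
        (π i.1).edgeMap ((T i.1).edgeOf (δ' i)) = e') ∧
      (∀ i, δ i ≠ δ' i ∧ (T i.1).abuts (δ i) = some (m i) ∧ (T i.1).abuts (δ' i) = some (m i)) ∧
      (∀ ⦃i i' : {i : J // j₀ ≤ i}⦄ (h : i.1 ≤ i'.1), (f h).vertexMap (m i') = m i ∧
        (f h).branchMap (δ i') = δ i ∧ (f h).branchMap (δ' i') = δ' i) ∧
      (∀ (i : {i : J // j₀ ≤ i}) (γ : C), (ρ i.1 γ).hom.vertexMap (m i) = m i ∧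
        (ρ i.1 γ).hom.branchMap (δ i) = δ i ∧ (ρ i.1 γ).hom.branchMap (δ' i) = δ' i) := by
  haveI : IsDirectedOrder {j : J // j₀ ≤ j} := isDirectedOrder_subtype_ge j₀
  -- the family of `C`-fixed subjoints whose branches lie over `e`, `e'`, at the levels `≥ j₀`
  let A : ∀ i : {i : J // j₀ ≤ i}, Set ((T i.1).Vertex × (T i.1).Branch × (T i.1).Branch) :=
    fun i =>
    {p | (π i.1).vertexMap p.1 = u ∧ (π i.1).edgeMap ((T i.1).edgeOf p.2.1) = e ∧
      (π i.1).edgeMap ((T i.1).edgeOf p.2.2) = e' ∧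
      (T i.1).abuts p.2.1 = some p.1 ∧ (T i.1).abuts p.2.2 = some p.1 ∧
      ∀ γ : C, (ρ i.1 γ).hom.vertexMap p.1 = p.1 ∧ (ρ i.1 γ).hom.branchMap p.2.1 = p.2.1 ∧
        (ρ i.1 γ).hom.branchMap p.2.2 = p.2.2}
  have hA : ∀ i, ∀ p ∈ A i, p.2.1 ≠ p.2.2 ∧ (T i.1).abuts p.2.1 = some p.1 ∧
      (T i.1).abuts p.2.2 = some p.1 ∧ ∀ γ : C, (ρ i.1 γ).hom.vertexMap p.1 = p.1 ∧
        (ρ i.1 γ).hom.branchMap p.2.1 = p.2.1 ∧ (ρ i.1 γ).hom.branchMap p.2.2 = p.2.2 := by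
    rintro i p ⟨-, hb, hb', ha, ha', hfix⟩
    refine ⟨fun heq => hee' ?_, ha, ha', hfix⟩
    rw [← hb, ← hb', heq]
  have hAne : ∀ i, (A i).Nonempty := by
    intro i
    obtain ⟨w, ε, ε', hw, hε, hε', ⟨β, hβe, hβw⟩, ⟨β', hβ'e, hβ'w⟩, hfix⟩ := hne i.1 i.2
    refine ⟨(w, β, β'), hw, by rw [hβe, hε], by rw [hβ'e, hε'], hβw, hβ'w,
      fun γ => ⟨(hfix γ).1, ?_, ?_⟩⟩
    · exact branchMap_eq_of_edgeMap_vertexMap_eq (hT i.1) (ρ i.1 γ) hβw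
        (by rw [hβe]; exact (hfix γ).2.1) (hfix γ).1
    · exact branchMap_eq_of_edgeMap_vertexMap_eq (hT i.1) (ρ i.1 γ) hβ'w
        (by rw [hβ'e]; exact (hfix γ).2.2) (hfix γ).1
  have hAfin : ∀ i, (A i).Finite := by
    intro i
    let V : Set (T i.1).Vertex :=
      {w | (π i.1).vertexMap w = u ∧ ∀ γ : C, (ρ i.1 γ).hom.vertexMap w = w}
    let E : Set (T i.1).Edge := ⋃ w ∈ V, {ε : (T i.1).Edge | (T i.1).EdgeAbuts ε w ∧
      ((π i.1).edgeMap ε = e ∨ (π i.1).edgeMap ε = e')}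
    let W : Set (T i.1).Branch := {β | (T i.1).edgeOf β ∈ E}
    have hV : V.Finite := hfinV i.1 i.2
    have hE : E.Finite := hV.biUnion fun w _ => hfinE i.1 i.2 w
    have hW : W.Finite := finite_branches_of_finite_edges hE
    refine (hV.prod (hW.prod hW)).subset ?_
    rintro ⟨w, β, β'⟩ ⟨hw, hβ, hβ', ha, ha', hfix⟩
    have hwV : w ∈ V := ⟨hw, fun γ => (hfix γ).1⟩
    refine ⟨hwV, ?_, ?_⟩
    · exact Set.mem_biUnion hwV ⟨⟨β, rfl, ha⟩, Or.inl hβ⟩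
    · exact Set.mem_biUnion hwV ⟨⟨β', rfl, ha'⟩, Or.inr hβ'⟩
  have hAmap : ∀ ⦃i i' : {i : J // j₀ ≤ i}⦄ (h : i ≤ i'), ∀ p ∈ A i',
      ((f (show i.1 ≤ i'.1 from h)).vertexMap p.1, (f (show i.1 ≤ i'.1 from h)).branchMap p.2.1,
        (f (show i.1 ≤ i'.1 from h)).branchMap p.2.2) ∈ A i := by
    rintro i i' h p ⟨hw, hb, hb', ha, ha', hfix⟩
    have h' : i.1 ≤ i'.1 := h
    refine ⟨by rw [vertexMap_over T f π hover h', hw],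
      by rw [(f h').edgeOf_branchMap, edgeMap_over T f π hover h', hb],
      by rw [(f h').edgeOf_branchMap, edgeMap_over T f π hover h', hb'],
      (f h').abuts_branchMap _ _ ha, (f h').abuts_branchMap _ _ ha', fun γ => ⟨?_, ?_, ?_⟩⟩
    · rw [vertexMap_equiv T ρ f hequiv h', (hfix γ).1]
    · rw [branchMap_equiv T ρ f hequiv h', (hfix γ).2.1]
    · rw [branchMap_equiv T ρ f hequiv h', (hfix γ).2.2]
  obtain ⟨m, δ, δ', hmem, hpair, hcompat, hfix⟩ :=
    exists_fixedSubjointSystem_of_finite_family (J := {j : J // j₀ ≤ j}) C (fun i => T i.1)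
      (fun i => ρ i.1) (fun i i' (h : i ≤ i') => f (show i.1 ≤ i'.1 from h)) (fun i => hid i.1)
      (fun i i' k hii' hi'k => hcomp _ _) A hA hAne hAfin hAmap
  exact ⟨m, δ, δ', fun i => ⟨(hmem i).1, (hmem i).2.1, (hmem i).2.2.1⟩, hpair,
    fun i i' h => hcompat (show i ≤ i' from h), hfix⟩

/-- **Cofinal nonemptiness suffices (edge currency)**: in `exists_fixedSubjointSystem_over_edges`
it is enough that the `C`-fixed edge-pair datum over `(u; e, e')` exists at a COFINAL set of levels
above `j₀` — its images (`fixedEdgePairOver_map`) supply the other levels.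
[cite: MochizukiSemiAnbd2006, Thm. 3.7(iii) p.41] -/
theorem exists_fixedSubjointSystem_over_edges_of_cofinal [IsDirectedOrder J]
    (hT : ∀ j, (T j).IsTree) (hid : ∀ j, f (le_refl j) = 𝟙 (T j))
    (hcomp : ∀ ⦃i j k : J⦄ (hij : i ≤ j) (hjk : j ≤ k), f hjk ≫ f hij = f (hij.trans hjk))
    (hover : ∀ ⦃i j : J⦄ (h : i ≤ j), f h ≫ π i = π j)
    (hequiv : ∀ ⦃i j : J⦄ (h : i ≤ j) (g : P), (ρ j g).hom ≫ f h = f h ≫ (ρ i g).hom)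
    (u : B.Vertex) (e e' : B.Edge) (hee' : e ≠ e') (j₀ : J)
    (hcof : ∀ i, j₀ ≤ i → ∃ j, i ≤ j ∧ ∃ (w : (T j).Vertex) (ε ε' : (T j).Edge),
      (π j).vertexMap w = u ∧ (π j).edgeMap ε = e ∧ (π j).edgeMap ε' = e' ∧
      (T j).EdgeAbuts ε w ∧ (T j).EdgeAbuts ε' w ∧
      ∀ γ : C, (ρ j γ).hom.vertexMap w = w ∧ (ρ j γ).hom.edgeMap ε = ε ∧
        (ρ j γ).hom.edgeMap ε' = ε')
    (hfinV : ∀ j, j₀ ≤ j → {w : (T j).Vertex | (π j).vertexMap w = u ∧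
      ∀ γ : C, (ρ j γ).hom.vertexMap w = w}.Finite)
    (hfinE : ∀ j, j₀ ≤ j → ∀ w : (T j).Vertex, {ε : (T j).Edge | (T j).EdgeAbuts ε w ∧
      ((π j).edgeMap ε = e ∨ (π j).edgeMap ε = e')}.Finite) :
    ∃ (m : ∀ i : {i : J // j₀ ≤ i}, (T i.1).Vertex)
      (δ δ' : ∀ i : {i : J // j₀ ≤ i}, (T i.1).Branch),
      (∀ i, (π i.1).vertexMap (m i) = u ∧ (π i.1).edgeMap ((T i.1).edgeOf (δ i)) = e ∧
        (π i.1).edgeMap ((T i.1).edgeOf (δ' i)) = e') ∧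
      (∀ i, δ i ≠ δ' i ∧ (T i.1).abuts (δ i) = some (m i) ∧ (T i.1).abuts (δ' i) = some (m i)) ∧
      (∀ ⦃i i' : {i : J // j₀ ≤ i}⦄ (h : i.1 ≤ i'.1), (f h).vertexMap (m i') = m i ∧
        (f h).branchMap (δ i') = δ i ∧ (f h).branchMap (δ' i') = δ' i) ∧
      (∀ (i : {i : J // j₀ ≤ i}) (γ : C), (ρ i.1 γ).hom.vertexMap (m i) = m i ∧
        (ρ i.1 γ).hom.branchMap (δ i) = δ i ∧ (ρ i.1 γ).hom.branchMap (δ' i) = δ' i) := by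
  refine exists_fixedSubjointSystem_over_edges C T ρ f π hT hid hcomp hover hequiv u e e' hee' j₀
    ?_ hfinV hfinE
  intro i hi
  obtain ⟨j, hij, w, ε, ε', hw⟩ := hcof i hi
  exact ⟨(f hij).vertexMap w, (f hij).edgeMap ε, (f hij).edgeMap ε',
    fixedEdgePairOver_map C T ρ f π hover hequiv u e e' hij w ε ε' hw⟩

/-- **The composed kill, edge currency**: under the hypotheses of `exists_fixedSubjointSystem_over_edges`
and the estrangement input of abc-iut-L3-t10's `SemiGraph.eq_bot_of_fixedSubjointSystem`, `C = ⊥`.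
[cite: MochizukiSemiAnbd2006, Thm. 3.7(iii) p.41] -/
theorem eq_bot_of_fixedEdgePairs_over [IsDirectedOrder J] (hT : ∀ j, (T j).IsTree)
    (hid : ∀ j, f (le_refl j) = 𝟙 (T j))
    (hcomp : ∀ ⦃i j k : J⦄ (hij : i ≤ j) (hjk : j ≤ k), f hjk ≫ f hij = f (hij.trans hjk))
    (hover : ∀ ⦃i j : J⦄ (h : i ≤ j), f h ≫ π i = π j)
    (hequiv : ∀ ⦃i j : J⦄ (h : i ≤ j) (g : P), (ρ j g).hom ≫ f h = f h ≫ (ρ i g).hom)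
    (G : J → SemiGraph.{u}) (τ : ∀ j, P →* Aut (G j)) (q : ∀ j, T j ⟶ G j)
    (hq : ∀ j, IsImmersion (q j)) (hqe : ∀ (j : J) (g : P), (ρ j g).hom ≫ q j = q j ≫ (τ j g).hom)
    (gf : ∀ ⦃i j : J⦄, i ≤ j → (G j ⟶ G i)) (hsq : ∀ ⦃i j : J⦄ (h : i ≤ j), f h ≫ q i = q j ≫ gf h)
    (hnobp : ∀ (j₀ : J) (w : ∀ i : {i : J // j₀ ≤ i}, (G i.1).Vertex)
      (β β' : ∀ i : {i : J // j₀ ≤ i}, (G i.1).Branch),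
      (∀ i, β i ≠ β' i ∧ (G i.1).abuts (β i) = some (w i) ∧ (G i.1).abuts (β' i) = some (w i)) →
      (∀ ⦃i i' : {i : J // j₀ ≤ i}⦄ (h : i.1 ≤ i'.1), (gf h).vertexMap (w i') = w i ∧
        (gf h).branchMap (β i') = β i ∧ (gf h).branchMap (β' i') = β' i) →
      (∀ (i : {i : J // j₀ ≤ i}) (γ : C), (τ i.1 γ).hom.vertexMap (w i) = w i ∧
        (τ i.1 γ).hom.branchMap (β i) = β i ∧ (τ i.1 γ).hom.branchMap (β' i) = β' i) → C = ⊥)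
    (u : B.Vertex) (e e' : B.Edge) (hee' : e ≠ e') (j₀ : J)
    (hne : ∀ j, j₀ ≤ j → ∃ (w : (T j).Vertex) (ε ε' : (T j).Edge), (π j).vertexMap w = u ∧
      (π j).edgeMap ε = e ∧ (π j).edgeMap ε' = e' ∧ (T j).EdgeAbuts ε w ∧ (T j).EdgeAbuts ε' w ∧
      ∀ γ : C, (ρ j γ).hom.vertexMap w = w ∧ (ρ j γ).hom.edgeMap ε = ε ∧
        (ρ j γ).hom.edgeMap ε' = ε')
    (hfinV : ∀ j, j₀ ≤ j → {w : (T j).Vertex | (π j).vertexMap w = u ∧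
      ∀ γ : C, (ρ j γ).hom.vertexMap w = w}.Finite)
    (hfinE : ∀ j, j₀ ≤ j → ∀ w : (T j).Vertex, {ε : (T j).Edge | (T j).EdgeAbuts ε w ∧
      ((π j).edgeMap ε = e ∨ (π j).edgeMap ε = e')}.Finite) :
    C = ⊥ := by
  obtain ⟨m, δ, δ', -, hpair, hcompat, hfix⟩ :=
    exists_fixedSubjointSystem_over_edges C T ρ f π hT hid hcomp hover hequiv u e e' hee' j₀ hne
      hfinV hfinE
  exact eq_bot_of_fixedSubjointSystem C T ρ f G τ q hq hqe gf hsq hnobp j₀ m δ δ' hpair hcompat hfix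

end Over

end SemiGraph

end Literature.AnabelianGeometry.SemiGraphs
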